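import Literature.Barriers.CriticalPhenomena.GridSAWTowers
import HarnessLib

/-!
# Barrier `GridSAWCountingSharpPComplete`, squares step (1/4): a congestion-free grid drawing
# scaled by a factor is a congestion-free grid drawing

Sibling of `GridSAWCountingSharpPComplete.lean` (the barrier: Liśkiewicz–Ogihara–Toda 2003,
Theorem 7 (1) ∧ (4)), `GridSAWCountingViaGridHamPath.lean` (the pivot problem `GRIDHAMPATHCOUNT`
on congestion-free grid drawings `(P, D, s, t)`, `IsGridDrawing`),
`GridSAWCountingAnyLengthViaGridHamPath.lean` (the named sub-fact
`LOT2003_thm7_anyLength_squares : GRIDHAMPATHCOUNT ≤ᵖ_{r-shift} SAWCOUNT₄`, whose discharge this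
series of files works towards) and — for all the vocabulary — `GridSAWTowers.lean`, the tower
step of version (1): run points `runPt M a u i = M a + i u`, scaled paths `scalePath M π`
("transforming each edge `((a; b); (a′; b′))` … to the straight line of length `λ` between
`(λa; λb)` and `(λa′; λb′)`" [LOT2003, §4, proof of Theorem 7, PDF p. 11]), scaled vertex images
`P.map ((M : ℤ) • ·)`, and their lemmas (`mem_scalePath`, `nodup_scalePath`,
`isChain_scalePath`, `runPt_eq_runPt`, `smul_eq_runPt`, `sameEnds_of_two_common`, …).

`GridSAWTowers.isGridDrawing_uniformize` proves that the TOWERED re-drawing is again a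
congestion-free grid drawing; the squares step of version (4) needs the same for PURE scaling
(no towers: only "each edge is realized by a set of `2^β` paths" matters there), which is what
this short file supplies, over the same vocabulary:

* `scaleDrawing k D` (every drawn path replaced by `scalePath k`), `map_ends_scaleDrawing`,
  `drawnDegree_scaleDrawing`, `hamPathCount_scaleDrawing`, `dAdj_scaleDrawing` (same abstract
  graph);
* `runFrom_nil_eq_map` and `getElem_scalePath_lt` (the first `k` points of a scaled path are
  the run points of its first unit edge — where the squares will stand);
* `isDrawnEdgeOf_scalePath`, `scalePath_common` and **`IsGridDrawing.scale`**: for `0 < k`,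
  `(P.map ((k : ℤ) • ·), scaleDrawing k D)` is a congestion-free grid drawing whenever `(P, D)`
  is; `isGridSubgraph_drawnEdges_scaleDrawing`.

Everything here is proved.

## References

* M. Liśkiewicz, M. Ogihara, S. Toda, *The complexity of counting self-avoiding walks in
  subgraphs of two-dimensional grids and hypercubes*, TCS 304 (2003) 129–156, §4, proof of
  Theorem 7 (`E₁`, `E₂`, `E₃`: "enlarge by a factor").
-/

namespace Literature.Barriers.CriticalPhenomena.GridSAW

/-! ### The scaled drawing -/

/-- **The drawing `D` scaled by the factor `k`**: same abstract edges, every drawn path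
replaced by `scalePath k` ("We enlarge `E₀` by a factor of four … We enlarge `E₂` by a factor
of `λ`"). [cite: LiskiewiczOgiharaToda2003, §4 (proof of Theorem 7, E₁, E₂, E₃)] -/
def scaleDrawing (k : ℕ) (D : List DrawnEdge) : List DrawnEdge :=
  D.map fun e => (e.1, e.2.1, scalePath k e.2.2)

/-- The scaled drawn edges have the same ends. [folklore] -/
theorem map_ends_scaleDrawing (k : ℕ) (D : List DrawnEdge) :
    (scaleDrawing k D).map (fun e => (e.1, e.2.1)) = D.map (fun e => (e.1, e.2.1)) := by
  simp [scaleDrawing]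

/-- Scaling does not change the vertex degrees. [folklore] -/
theorem drawnDegree_scaleDrawing (k : ℕ) (D : List DrawnEdge) (v : ℕ) :
    drawnDegree (scaleDrawing k D) v = drawnDegree D v := by
  simp [drawnDegree, scaleDrawing, List.countP_map, Function.comp_def]

/-- Scaling does not change the abstract adjacency. [folklore] -/
theorem dAdj_scaleDrawing (k : ℕ) (D : List DrawnEdge) (a b : ℕ) :
    DAdj (scaleDrawing k D) a b ↔ DAdj D a b := by
  simp only [DAdj, scaleDrawing, List.mem_map]
  constructor
  · rintro ⟨_, ⟨e, he, rfl⟩, h⟩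
    exact ⟨e, he, h⟩
  · rintro ⟨e, he, h⟩
    exact ⟨_, ⟨e, he, rfl⟩, h⟩

/-- **Scaling does not change the number of Hamiltonian paths.**
[cite: LiskiewiczOgiharaToda2003, §4 (proof of Theorem 7: E₁, E₂, E₃ realise the same graph G′)] -/
theorem hamPathCount_scaleDrawing (k N : ℕ) (D : List DrawnEdge) (s t : ℕ) :
    hamPathCount N (scaleDrawing k D) s t = hamPathCount N D s t :=
  hamPathCount_eq_of_map_ends_eq (map_ends_scaleDrawing k D) s t

/-- The scaled drawn edge of `e`. [folklore] -/
theorem mem_scaleDrawing {k : ℕ} {D : List DrawnEdge} {e : DrawnEdge} (he : e ∈ D) :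
    (e.1, e.2.1, scalePath k e.2.2) ∈ scaleDrawing k D :=
  List.mem_map.mpr ⟨e, he, rfl⟩

/-- Members of the scaled drawing. [folklore] -/
theorem exists_of_mem_scaleDrawing {k : ℕ} {D : List DrawnEdge} {e' : DrawnEdge}
    (he' : e' ∈ scaleDrawing k D) : ∃ e ∈ D, e' = (e.1, e.2.1, scalePath k e.2.2) := by
  obtain ⟨e, he, rfl⟩ := List.mem_map.mp he'
  exact ⟨e, he, rfl⟩

/-! ### The first run of a scaled path -/

/-- A tower-free run lists the run points `t, …, t + n - 1`. [folklore] -/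
theorem runFrom_nil_eq_map (k : ℕ) (a u : GridPoint) (h : ℕ) :
    ∀ n t : ℕ, runFrom k a u [] h t n = (List.range' t n).map (runPt k a u)
  | 0, t => by simp [runFrom]
  | n + 1, t => by
    rw [runFrom, runFrom_nil_eq_map k a u h n (t + 1), List.range'_succ, List.map_cons]
    simp [runBlock]

/-- **The first `k` points of a scaled path are the run points of its first unit edge.**
[folklore] -/
theorem getElem_scalePath_lt {k : ℕ} (p q : GridPoint) (l : List GridPoint) {m : ℕ} (hm : m < k)
    (hm' : m < (scalePath k (p :: q :: l)).length) :
    (scalePath k (p :: q :: l))[m] = runPt k p (q - p) m := by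
  simp only [scalePath, runFrom_nil_eq_map]
  rw [List.getElem_append_left (by simpa using hm)]
  simp

section Drawing

variable {P : List GridPoint} {D : List DrawnEdge}

/-- **A scaled drawn edge is correctly drawn** with respect to the scaled vertex images
(`0 < k`). [cite: LiskiewiczOgiharaToda2003, §4 (proof of Theorem 7: "we move each point (a, b) to (4a, 4b)")] -/
theorem isDrawnEdgeOf_scalePath (hD : IsGridDrawing P D) {k : ℕ} (hk : 0 < k) {e : DrawnEdge}
    (he : e ∈ D) : IsDrawnEdgeOf (P.map fun p => (k : ℤ) • p) (e.1, e.2.1, scalePath k e.2.2) := by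
  have hde := hD.2.1 e he
  have hk' : ((k : ℕ) : ℤ) ≠ 0 := by exact_mod_cast hk.ne'
  obtain ⟨p, q, l, hπ⟩ := exists_eq_cons_cons_of_mem hD he
  obtain ⟨h1, h2, hne, hhead, hlast, hnd, hch, hint⟩ := hde
  rw [hπ] at hhead hlast hnd hch
  refine ⟨by simpa using h1, by simpa using h2, hne, ?_, ?_, ?_, ?_, ?_⟩
  · dsimp only; rw [hπ, head?_scalePath hk, getElem?_map_smul, ← hhead]; rfl
  · dsimp only
    rw [hπ, getLast?_scalePath, getElem?_map_smul, ← hlast, List.getLast?_eq_some_getLast]; rfl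
  · dsimp only; rw [hπ]; exact nodup_scalePath p (q :: l) hnd hch
  · dsimp only; rw [hπ]; exact isChain_scalePath hk p (q :: l) hch
  · dsimp only
    intro X hX hXP
    rw [hπ] at hX
    obtain ⟨x, hxP, rfl⟩ := mem_map_smul.1 hXP
    rcases (mem_scalePath p (q :: l)).1 hX with ⟨i, hi, s', hs', h⟩ | h
    · obtain ⟨rfl, rfl⟩ := smul_eq_runPt (isUnitVec_step hch hi) hs' h
      have hmem : (p :: q :: l)[i]'(Nat.lt_of_succ_lt hi) ∈ e.2.2 := by
        rw [hπ]; exact List.getElem_mem _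
      exact end_of_mem_P (hD.2.1 e he) hmem hxP _
    · have hx : x = (p :: q :: l).getLast (List.cons_ne_nil _ _) := smul_right_injective _ hk' h
      have hmem : x ∈ e.2.2 := by rw [hx, hπ]; exact List.getLast_mem _
      exact end_of_mem_P (hD.2.1 e he) hmem hxP _

/-- **Two scaled drawn edges meet only in scaled vertex images** (for drawn edges with
different ends meeting only in vertex images): two runs share an inner point only if they
traverse the same unit edge (`runPt_eq_runPt`), and two drawn edges sharing a unit edge would
pass through two common vertex images (`sameEnds_of_two_common`).
[cite: LiskiewiczOgiharaToda2003, §4 (proof of Theorem 7: enlarging "does not interfere with the other paths")] -/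
theorem scalePath_common (hD : IsGridDrawing P D) {k : ℕ} {e e' : DrawnEdge}
    (he : e ∈ D) (he' : e' ∈ D) (hns : ¬ SameEnds e e') (hcf : ∀ x ∈ e.2.2, x ∈ e'.2.2 → x ∈ P) :
    ∀ X ∈ scalePath k e.2.2, X ∈ scalePath k e'.2.2 → X ∈ P.map fun p => (k : ℤ) • p := by
  intro X hX hX'
  have hde := hD.2.1 e he
  have hde' := hD.2.1 e' he'
  obtain ⟨p, q, l, hπ⟩ := exists_eq_cons_cons_of_mem hD he
  obtain ⟨p', q', l', hπ'⟩ := exists_eq_cons_cons_of_mem hD he'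
  have hnd := hde.2.2.2.2.2.1; have hch := hde.2.2.2.2.2.2.1
  have hch' := hde'.2.2.2.2.2.2.1
  rw [hπ] at hnd hch hX; rw [hπ'] at hch' hX'
  have img : ∀ x ∈ P, (k : ℤ) • x ∈ P.map (fun p => (k : ℤ) • p) := fun x hx =>
    mem_map_smul.2 ⟨x, hx, rfl⟩
  have two : ∀ {x y : GridPoint}, x ≠ y → x ∈ p :: q :: l → x ∈ p' :: q' :: l' → y ∈ p :: q :: l →
      y ∈ p' :: q' :: l' → False := by
    intro x y hxy hx hx' hy hy'
    have hxP : x ∈ P := hcf x (hπ ▸ hx) (hπ' ▸ hx')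
    have hyP : y ∈ P := hcf y (hπ ▸ hy) (hπ' ▸ hy')
    exact hns (sameEnds_of_two_common hD.1 hde hde' hxy (hπ ▸ hx) (hπ' ▸ hx') (hπ ▸ hy) (hπ' ▸ hy')
      hxP hyP)
  rcases (mem_scalePath p (q :: l)).1 hX with ⟨i, hi, s, hs, rfl⟩ | rfl
  · rcases (mem_scalePath p' (q' :: l')).1 hX' with ⟨j, hj, s', hs', h⟩ | h
    · rcases runPt_eq_runPt (isUnitVec_step hch hi) (isUnitVec_step hch' hj) hs hs' h with
        ⟨rfl, -, hc⟩ | ⟨-, -, hc, hcu⟩ | ⟨-, -, hc, hcu, -⟩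
      · rw [runPt_zero]
        refine img _ (hcf _ ?_ ?_)
        · rw [hπ]; exact List.getElem_mem _
        · rw [hπ', hc]; exact List.getElem_mem _
      · exfalso
        have hc1 : (p :: q :: l)[i + 1] = (p' :: q' :: l')[j + 1] := by
          have e1 : (p :: q :: l)[i + 1] = (p :: q :: l)[i]'(Nat.lt_of_succ_lt hi) +
            ((p :: q :: l)[i + 1] - (p :: q :: l)[i]'(Nat.lt_of_succ_lt hi)) := by abel
          rw [e1, hcu, hc]; abel
        refine two (x := (p :: q :: l)[i]'(Nat.lt_of_succ_lt hi)) (y := (p :: q :: l)[i + 1])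
          (fun h => ?_) (List.getElem_mem _) (by rw [hc]; exact List.getElem_mem _)
          (List.getElem_mem _) (by rw [hc1]; exact List.getElem_mem _)
        have := (hnd.getElem_inj_iff).1 h; omega
      · exfalso
        have hc0 : (p' :: q' :: l')[j]'(Nat.lt_of_succ_lt hj) = (p :: q :: l)[i + 1] := by
          rw [hc]; abel
        have hc1 : (p' :: q' :: l')[j + 1] = (p :: q :: l)[i]'(Nat.lt_of_succ_lt hi) := by
          have e2 : (p' :: q' :: l')[j + 1] = (p' :: q' :: l')[j]'(Nat.lt_of_succ_lt hj) +
            ((p' :: q' :: l')[j + 1] - (p' :: q' :: l')[j]'(Nat.lt_of_succ_lt hj)) := by abel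
          rw [e2, hcu, hc]; abel
        refine two (x := (p :: q :: l)[i]'(Nat.lt_of_succ_lt hi)) (y := (p :: q :: l)[i + 1])
          (fun h => ?_) (List.getElem_mem _) (by rw [← hc1]; exact List.getElem_mem _)
          (List.getElem_mem _) (by rw [← hc0]; exact List.getElem_mem _)
        have := (hnd.getElem_inj_iff).1 h; omega
    · rw [h]; exact img _ (getLast_mem_P hde' hπ')
  · exact img _ (getLast_mem_P hde hπ)

/-- **Scaling a congestion-free grid drawing gives a congestion-free grid drawing** (vertex
images `k • P`, every drawn path replaced by `scalePath k`; `0 < k`).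
[cite: LiskiewiczOgiharaToda2003, §4 (proof of Theorem 7: "We enlarge E₀ by a factor of four … Since we have already enlarged E₀ by a factor of four, bending … does not interfere with the other paths")] -/
theorem IsGridDrawing.scale (hD : IsGridDrawing P D) {k : ℕ} (hk : 0 < k) :
    IsGridDrawing (P.map fun p => (k : ℤ) • p) (scaleDrawing k D) := by
  have hk' : ((k : ℕ) : ℤ) ≠ 0 := by exact_mod_cast hk.ne'
  refine ⟨?_, ?_, ?_, ?_, ?_⟩
  · exact hD.1.map (smul_right_injective _ hk')
  · intro e₂ he₂
    obtain ⟨e, he, rfl⟩ := List.mem_map.1 he₂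
    exact isDrawnEdgeOf_scalePath hD hk he
  · rw [scaleDrawing, List.pairwise_map]
    exact hD.2.2.1.imp fun h => h
  · rw [scaleDrawing, List.pairwise_map]
    have h := (hD.2.2.1.and hD.2.2.2.1)
    rw [List.Pairwise.and_mem] at h
    exact h.imp fun ⟨he, he', hns, hcf⟩ => scalePath_common hD he he' hns hcf
  · intro v hv
    rw [drawnDegree_scaleDrawing]
    exact hD.2.2.2.2 v (by simpa using hv)

/-- The realised subgraph of the scaled drawing is a subgraph of the grid. [folklore] -/
theorem isGridSubgraph_drawnEdges_scaleDrawing (hD : IsGridDrawing P D) {k : ℕ} (hk : 0 < k) :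
    IsGridSubgraph (drawnEdges (scaleDrawing k D)) :=
  isGridSubgraph_drawnEdges (hD.scale hk)

/-- In the scaled drawing, a point common to two distinct scaled drawn edges is a scaled vertex
image (`IsGridDrawing.mem_of_mem_mem` for `IsGridDrawing.scale`, with the edges named by their
originals). [folklore] -/
theorem IsGridDrawing.smul_of_mem_scalePath (hD : IsGridDrawing P D) {k : ℕ} (hk : 0 < k)
    {e e' : DrawnEdge} (he : e ∈ D) (he' : e' ∈ D) (hne : e ≠ e') {X : GridPoint}
    (hX : X ∈ scalePath k e.2.2) (hX' : X ∈ scalePath k e'.2.2) : X ∈ P.map fun p => (k : ℤ) • p := by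
  have hne' : (e.1, e.2.1, scalePath k e.2.2) ≠ (e'.1, e'.2.1, scalePath k e'.2.2) := by
    intro h
    simp only [Prod.mk.injEq] at h
    rcases pairwise_mem_mem hD.2.2.1 he he' hne with hh | hh
    · exact hh (Or.inl ⟨h.1, h.2.1⟩)
    · exact hh (Or.inl ⟨h.1.symm, h.2.1.symm⟩)
  exact (hD.scale hk).mem_of_mem_mem (mem_scaleDrawing he) (mem_scaleDrawing he') hne' hX hX'

end Drawing

/-! ### Sanity checks -/

/-- Scaling the one-edge drawing `(0,0) — (0,1)` by two gives the path `(0,0), (0,1), (0,2)`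
with vertex images `(0,0)` and `(0,2)`. [folklore] -/
theorem scaleDrawing_two_oneEdge :
    scaleDrawing 2 oneEdgeDrawing.2 = [(0, 1, [((0 : ℤ), (0 : ℤ)), (0, 1), (0, 2)])] ∧
      (oneEdgeDrawing.1.map fun p => ((2 : ℕ) : ℤ) • p) = [((0 : ℤ), (0 : ℤ)), (0, 2)] := by
  refine ⟨?_, ?_⟩ <;> decide

/-- … and it is again a congestion-free grid drawing (an instance of `IsGridDrawing.scale`).
[folklore] -/
theorem isGridDrawing_scale_oneEdge :
    IsGridDrawing (oneEdgeDrawing.1.map fun p => ((2 : ℕ) : ℤ) • p) (scaleDrawing 2 oneEdgeDrawing.2) :=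
  isGridDrawing_oneEdge.scale (by norm_num)

end Literature.Barriers.CriticalPhenomena.GridSAW
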